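import Literature.Barriers.QuantumAdvantage.AaronsonChenOracle
import HarnessLib

/-!
# `TQBF` is `PSPACE`-hard, I: the prenex Savitch formula over an abstract step formula

Arora–Barak 2009, Thm. 4.13, second half of the proof (p. 112): for configurations coded by
`m`-bit strings and a formula `φ_{M,x}(C, C')` expressing adjacency in the configuration graph,
"`ψᵢ(C, C')`: there is a path of length at most `2ⁱ` from `C` to `C'`", defined succinctly as
`ψᵢ(C, C') = ∃C'' ∀D¹ ∀D² ((D¹ = C ∧ D² = C'') ∨ (D¹ = C'' ∧ D² = C')) ⇒ ψᵢ₋₁(D¹, D²)`, so that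
`size(ψᵢ) ≤ size(ψᵢ₋₁) + O(m)`; "we can convert the final formula to prenex form".

This file builds that formula ONCE, for the tree's prenex QBFs (`PrenexQBF`/`qbfEval` of
`AaronsonChenOracle.lean`: the prefix lists the quantifiers of the variables `0, 1, 2, …` in
order), abstractly in the step formula, and proves its semantics:

* vector conventions: a configuration is a block of `N` consecutive variables; `readVec σ a N`
  reads the block at base `a`, `writeVec σ a w` writes it; the quantifier-block lemmas
  `qbfEval_replicate_false_append` / `qbfEval_replicate_true_append` (a block of `∃`/`∀` is an
  `∃`/`∀` over words of length `N`);
* formula combinators with their semantics and variable bounds: `bigConj`, `impF`, `bitEq`,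
  `vecEq a b N` (`readVec σ a N = readVec σ b N`), `vecConst a w` (`readVec σ a |w| = w`);
* `savitchMatrix`/`savitchQuants`/`savitchQBF Φ acc start N m`: variables `C_start` (base `0`,
  pinned to the constant word `start` by `vecConst`), `C_final` (base `N`), and for each level
  `t < m` (outermost first) the blocks `C''ₜ, Dₜ, D'ₜ` at base `2N + 3N·t`; prefix
  `∃^{2N} (∃^N ∀^{2N})^m`; matrix `start-pin ∧ acc(C_final) ∧ (G₀ ⇒ G₁ ⇒ ⋯ ⇒ G_{m-1} ⇒ Φ(D_{m-1}, D'_{m-1}))`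
  with the guards `Gₜ = (Dₜ = Xₜ ∧ D'ₜ = C''ₜ) ∨ (Dₜ = C''ₜ ∧ D'ₜ = Yₜ)`, `(X₀, Y₀) = (C_start, C_final)`,
  `(Xₜ₊₁, Yₜ₊₁) = (Dₜ, D'ₜ)` — the DETERMINISTIC form (paths of length EXACTLY `2^m`, which is what a
  deterministic machine run for exactly `2^m` steps needs; no reflexive closure);
* **`isTrue_savitchQBF_iff`**: if `Φ a b` expresses a relation `Step` between the blocks at `a`
  and `b`, and `acc a` a predicate `Acc` on the block at `a`, then the formula is true iff
  `∃ C_final, Acc C_final ∧ Reach Step m start C_final`, where `Reach Step 0 = Step` and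
  `Reach Step (ℓ+1) X Y = ∃ Z, Reach Step ℓ X Z ∧ Reach Step ℓ Z Y` ("the two definitions of
  `ψᵢ` are indeed logically equivalent"); `isClosed_savitchQBF` (closedness from variable bounds
  on `Φ`, `acc`).

Part II instantiates `Φ` with the one-step formula of a flat program (`SpaceMachinesFlat.lean`:
every `L ∈ PSPACE` has a flat witness) and part III generates the code of the formula in
polynomial time.

## References

* S. Arora, B. Barak, *Computational Complexity: A Modern Approach*, CUP 2009, Thm. 4.13 (proof,
  second half, p. 112), §4.2.1 [AroraBarakCC2009].
* W. J. Savitch, *Relationships between nondeterministic and deterministic tape complexities*,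
  JCSS 4 (1970) 177–192 (the recursive doubling; as cited by Arora–Barak, Thm. 4.14).
-/

namespace Literature.Barriers.QuantumAdvantage

open _root_.Computability Literature.Computability.Complexity

namespace TQBFRed

/-! ### Reading and writing blocks of variables -/

/-- The word read off `σ` at the `n` variables from base `a`. [folklore] -/
def readVec (σ : ℕ → Bool) (a n : ℕ) : List Bool := (List.range n).map fun j => σ (a + j)

/-- Writing a word into `σ` from base `a`. [folklore] -/
def writeVec (σ : ℕ → Bool) (a : ℕ) : List Bool → (ℕ → Bool)
  | [] => σ
  | b :: w => writeVec (Function.update σ a b) (a + 1) w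

/-- Length of a read word. [folklore] -/
@[simp] theorem length_readVec (σ : ℕ → Bool) (a n : ℕ) : (readVec σ a n).length = n := by simp [readVec]

/-- Entries of a read word. [folklore] -/
theorem getElem_readVec (σ : ℕ → Bool) (a n : ℕ) {j : ℕ} (h : j < (readVec σ a n).length) :
    (readVec σ a n)[j] = σ (a + j) := by
  simp [readVec]

/-- Reading one more variable. [folklore] -/
theorem readVec_succ (σ : ℕ → Bool) (a n : ℕ) : readVec σ a (n + 1) = σ a :: readVec σ (a + 1) n := by
  simp only [readVec, List.range_succ_eq_map, List.map_cons, List.map_map, Nat.add_zero]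
  congr 1
  exact List.map_congr_left fun j _ => by simp only [Function.comp_apply]; congr 1; omega

/-- Two reads agree iff the assignment agrees on the block. [folklore] -/
theorem readVec_eq_readVec_iff (σ τ : ℕ → Bool) (a b n : ℕ) :
    readVec σ a n = readVec τ b n ↔ ∀ j < n, σ (a + j) = τ (b + j) := by
  simp [readVec, List.map_inj_left]

/-- A read equals a word iff the assignment spells the word. [folklore] -/
theorem readVec_eq_iff (σ : ℕ → Bool) (a : ℕ) (w : List Bool) :
    readVec σ a w.length = w ↔ ∀ (j : ℕ) (h : j < w.length), σ (a + j) = w[j] := by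
  rw [List.ext_getElem_iff]
  simp [readVec]

/-- Writing does not touch variables below the base. [folklore] -/
theorem writeVec_of_lt (σ : ℕ → Bool) : ∀ (a : ℕ) (w : List Bool) {x : ℕ}, x < a → writeVec σ a w x = σ x
  | a, [], x, _ => rfl
  | a, b :: w, x, hx => by
    rw [writeVec, writeVec_of_lt _ (a + 1) w (by omega), Function.update_of_ne (by omega)]

/-- Writing does not touch variables beyond the block. [folklore] -/
theorem writeVec_of_ge (σ : ℕ → Bool) : ∀ (a : ℕ) (w : List Bool) {x : ℕ}, a + w.length ≤ x → writeVec σ a w x = σ x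
  | a, [], x, _ => rfl
  | a, b :: w, x, hx => by
    rw [writeVec, writeVec_of_ge _ (a + 1) w (by simp at hx; omega), Function.update_of_ne (by simp at hx; omega)]

/-- The written block reads back. [folklore] -/
theorem writeVec_add (σ : ℕ → Bool) : ∀ (a : ℕ) (w : List Bool) {j : ℕ} (h : j < w.length),
    writeVec σ a w (a + j) = w[j]
  | a, [], j, h => by simp at h
  | a, b :: w, 0, _ => by
    simp only [writeVec, Nat.add_zero, List.getElem_cons_zero]
    rw [writeVec_of_lt _ _ _ (Nat.lt_succ_self a), Function.update_self]
  | a, b :: w, j + 1, h => by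
    rw [writeVec, show a + (j + 1) = (a + 1) + j by omega, writeVec_add _ (a + 1) w (by simpa using h)]
    rfl

/-- Reading the written block. [folklore] -/
@[simp] theorem readVec_writeVec_self (σ : ℕ → Bool) (a : ℕ) (w : List Bool) :
    readVec (writeVec σ a w) a w.length = w :=
  (readVec_eq_iff _ _ _).2 fun _ h => writeVec_add σ a w h

/-- Reading a block disjoint from (below) the written one. [folklore] -/
theorem readVec_writeVec_of_le (σ : ℕ → Bool) (a : ℕ) (w : List Bool) {b n : ℕ} (h : b + n ≤ a) :
    readVec (writeVec σ a w) b n = readVec σ b n :=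
  (readVec_eq_readVec_iff _ _ _ _ _).2 fun j hj => writeVec_of_lt σ a w (by omega)

/-- Reading a block disjoint from (above) the written one. [folklore] -/
theorem readVec_writeVec_of_ge (σ : ℕ → Bool) (a : ℕ) (w : List Bool) {b n : ℕ} (h : a + w.length ≤ b) :
    readVec (writeVec σ a w) b n = readVec σ b n :=
  (readVec_eq_readVec_iff _ _ _ _ _).2 fun j _ => writeVec_of_ge σ a w (by omega)

/-! ### Blocks of quantifiers -/

/-- **A block of `n` existential quantifiers is an `∃` over words of length `n`.** [folklore] -/
theorem qbfEval_replicate_false_append (φ : PropForm ℕ) (rest : List Bool) :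
    ∀ (n i : ℕ) (σ : ℕ → Bool), qbfEval φ (List.replicate n false ++ rest) i σ = true ↔
      ∃ w : List Bool, w.length = n ∧ qbfEval φ rest (i + n) (writeVec σ i w) = true
  | 0, i, σ => ⟨fun h => ⟨[], rfl, by simpa [writeVec] using h⟩, by rintro ⟨w, hw, h⟩; cases w <;> simp_all [writeVec]⟩
  | n + 1, i, σ => by
    rw [List.replicate_succ, List.cons_append, qbfEval, cond_false, Bool.or_eq_true,
      qbfEval_replicate_false_append φ rest n (i + 1), qbfEval_replicate_false_append φ rest n (i + 1)]
    constructor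
    · rintro (⟨w, hw, h⟩ | ⟨w, hw, h⟩)
      · exact ⟨false :: w, by simp [hw], by rw [writeVec, show i + (n + 1) = i + 1 + n by omega]; exact h⟩
      · exact ⟨true :: w, by simp [hw], by rw [writeVec, show i + (n + 1) = i + 1 + n by omega]; exact h⟩
    · rintro ⟨w, hw, h⟩
      match w, hw with
      | b :: w, hw =>
        rw [writeVec, show i + (n + 1) = i + 1 + n by omega] at h
        cases b
        · exact Or.inl ⟨w, by simpa using hw, h⟩
        · exact Or.inr ⟨w, by simpa using hw, h⟩

/-- **A block of `n` universal quantifiers is a `∀` over words of length `n`.** [folklore] -/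
theorem qbfEval_replicate_true_append (φ : PropForm ℕ) (rest : List Bool) :
    ∀ (n i : ℕ) (σ : ℕ → Bool), qbfEval φ (List.replicate n true ++ rest) i σ = true ↔
      ∀ w : List Bool, w.length = n → qbfEval φ rest (i + n) (writeVec σ i w) = true
  | 0, i, σ => ⟨fun h w hw => by cases w <;> simp_all [writeVec], fun h => by simpa [writeVec] using h [] rfl⟩
  | n + 1, i, σ => by
    rw [List.replicate_succ, List.cons_append, qbfEval, cond_true, Bool.and_eq_true,
      qbfEval_replicate_true_append φ rest n (i + 1), qbfEval_replicate_true_append φ rest n (i + 1)]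
    constructor
    · rintro ⟨h₀, h₁⟩ w hw
      match w, hw with
      | b :: w, hw =>
        rw [writeVec, show i + (n + 1) = i + 1 + n by omega]
        cases b
        · exact h₀ w (by simpa using hw)
        · exact h₁ w (by simpa using hw)
    · intro h
      exact ⟨fun w hw => by have := h (false :: w) (by simp [hw]); rwa [writeVec, show i + (n + 1) = i + 1 + n by omega] at this,
        fun w hw => by have := h (true :: w) (by simp [hw]); rwa [writeVec, show i + (n + 1) = i + 1 + n by omega] at this⟩

/-! ### Formula combinators -/

/-- Conjunction of a list of formulas (right-nested, terminated by `⊤`). [folklore] -/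
def bigConj : List (PropForm ℕ) → PropForm ℕ
  | [] => .const true
  | φ :: l => .conj φ (bigConj l)

/-- Semantics of `bigConj`. [folklore] -/
theorem eval_bigConj (σ : ℕ → Bool) : ∀ l : List (PropForm ℕ), (bigConj l).eval σ = true ↔ ∀ φ ∈ l, φ.eval σ = true
  | [] => by simp [bigConj, PropForm.eval]
  | φ :: l => by simp [bigConj, PropForm.eval, eval_bigConj σ l]

/-- Variable bound of `bigConj`. [folklore] -/
theorem propFormVarBound_bigConj_le {l : List (PropForm ℕ)} {B : ℕ} (h : ∀ φ ∈ l, propFormVarBound φ ≤ B) :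
    propFormVarBound (bigConj l) ≤ B := by
  induction l with
  | nil => simp [bigConj, propFormVarBound]
  | cons φ l ih =>
    simp only [bigConj, propFormVarBound, max_le_iff]
    exact ⟨h φ (by simp), ih fun ψ hψ => h ψ (by simp [hψ])⟩

/-- Implication `A ⇒ B = ¬A ∨ B`. [folklore] -/
def impF (A B : PropForm ℕ) : PropForm ℕ := .disj (.neg A) B

/-- Semantics of `impF`. [folklore] -/
theorem eval_impF (σ : ℕ → Bool) (A B : PropForm ℕ) :
    (impF A B).eval σ = true ↔ (A.eval σ = true → B.eval σ = true) := by
  simp only [impF, PropForm.eval, Bool.or_eq_true, Bool.not_eq_true']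
  cases A.eval σ <;> simp

/-- Variable bound of `impF`. [folklore] -/
@[simp] theorem propFormVarBound_impF (A B : PropForm ℕ) :
    propFormVarBound (impF A B) = max (propFormVarBound A) (propFormVarBound B) := rfl

/-- Equality of two bits: `(u ∧ v) ∨ (¬u ∧ ¬v)`. [cite: AroraBarakCC2009, Example 4.11 ("= … informal shorthand")] -/
def bitEq (u v : ℕ) : PropForm ℕ :=
  .disj (.conj (.var u) (.var v)) (.conj (.neg (.var u)) (.neg (.var v)))

/-- Semantics of `bitEq`. [folklore] -/
theorem eval_bitEq (σ : ℕ → Bool) (u v : ℕ) : (bitEq u v).eval σ = true ↔ σ u = σ v := by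
  simp only [bitEq, PropForm.eval]
  cases σ u <;> cases σ v <;> simp

/-- Variable bound of `bitEq`. [folklore] -/
@[simp] theorem propFormVarBound_bitEq (u v : ℕ) : propFormVarBound (bitEq u v) = max (u + 1) (v + 1) := by
  simp [bitEq, propFormVarBound]

/-- Equality of the blocks of `n` variables at bases `a` and `b`. [cite: AroraBarakCC2009, Thm. 4.13 (proof: "D¹ = C")] -/
def vecEq (a b n : ℕ) : PropForm ℕ := bigConj ((List.range n).map fun j => bitEq (a + j) (b + j))

/-- **Semantics of `vecEq`**: the two blocks read the same word. [folklore] -/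
theorem eval_vecEq (σ : ℕ → Bool) (a b n : ℕ) : (vecEq a b n).eval σ = true ↔ readVec σ a n = readVec σ b n := by
  rw [vecEq, eval_bigConj, readVec_eq_readVec_iff]
  simp [eval_bitEq]

/-- Variable bound of `vecEq`. [folklore] -/
theorem propFormVarBound_vecEq_le (a b n : ℕ) : propFormVarBound (vecEq a b n) ≤ max (a + n) (b + n) := by
  refine propFormVarBound_bigConj_le fun φ hφ => ?_
  simp only [List.mem_map, List.mem_range] at hφ
  obtain ⟨j, hj, rfl⟩ := hφ
  rw [propFormVarBound_bitEq]
  omega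

/-- A literal pinning variable `u` to the bit `b`. [folklore] -/
def bitLit (u : ℕ) (b : Bool) : PropForm ℕ := cond b (.var u) (.neg (.var u))

/-- Semantics of `bitLit`. [folklore] -/
theorem eval_bitLit (σ : ℕ → Bool) (u : ℕ) (b : Bool) : (bitLit u b).eval σ = true ↔ σ u = b := by
  cases b <;> simp [bitLit, PropForm.eval]

/-- Variable bound of `bitLit`. [folklore] -/
@[simp] theorem propFormVarBound_bitLit (u : ℕ) (b : Bool) : propFormVarBound (bitLit u b) = u + 1 := by
  cases b <;> rfl

/-- The block at base `a` spells the constant word `w`. [cite: AroraBarakCC2009, Thm. 4.13 (proof: "plugging in the values C_start")] -/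
def vecConst : ℕ → List Bool → PropForm ℕ
  | _, [] => .const true
  | a, b :: w => .conj (bitLit a b) (vecConst (a + 1) w)

/-- **Semantics of `vecConst`**: the block reads the word. [folklore] -/
theorem eval_vecConst (σ : ℕ → Bool) : ∀ (a : ℕ) (w : List Bool),
    (vecConst a w).eval σ = true ↔ readVec σ a w.length = w
  | a, [] => by simp [vecConst, PropForm.eval, readVec]
  | a, b :: w => by
    rw [vecConst, PropForm.eval, Bool.and_eq_true, eval_bitLit, eval_vecConst σ (a + 1) w, List.length_cons,
      readVec_succ, List.cons.injEq]

/-- Variable bound of `vecConst`. [folklore] -/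
theorem propFormVarBound_vecConst_le : ∀ (a : ℕ) (w : List Bool), propFormVarBound (vecConst a w) ≤ a + w.length
  | a, [] => by simp [vecConst, propFormVarBound]
  | a, b :: w => by
    simp only [vecConst, propFormVarBound, propFormVarBound_bitLit, List.length_cons, max_le_iff]
    have := propFormVarBound_vecConst_le (a + 1) w
    omega

/-! ### The Savitch formula -/

section Savitch

variable (Φ : ℕ → ℕ → PropForm ℕ) (acc : ℕ → PropForm ℕ) (start : List Bool) (N m : ℕ)

/-- Base of the block triple `C''ₜ, Dₜ, D'ₜ` of level `t` (outermost level `t = 0`):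
`2N + 3N·t` (after `C_start` at `0` and `C_final` at `N`). [folklore] -/
def lvl (t : ℕ) : ℕ := 2 * N + 3 * N * t

/-- Base of the source block `Xₜ` of level `t`: `C_start` for `t = 0`, `Dₜ₋₁` else. [folklore] -/
def xb : ℕ → ℕ
  | 0 => 0
  | t + 1 => lvl N t + N

/-- Base of the target block `Yₜ` of level `t`: `C_final` for `t = 0`, `D'ₜ₋₁` else. [folklore] -/
def yb : ℕ → ℕ
  | 0 => N
  | t + 1 => lvl N t + 2 * N

/-- The guard of level `t`: `(Dₜ = Xₜ ∧ D'ₜ = C''ₜ) ∨ (Dₜ = C''ₜ ∧ D'ₜ = Yₜ)`.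
[cite: AroraBarakCC2009, Thm. 4.13 (proof, the succinct definition of ψᵢ)] -/
def guard (t : ℕ) : PropForm ℕ :=
  .disj (.conj (vecEq (lvl N t + N) (xb N t) N) (vecEq (lvl N t + 2 * N) (lvl N t) N))
    (.conj (vecEq (lvl N t + N) (lvl N t) N) (vecEq (lvl N t + 2 * N) (yb N t) N))

/-- The chain of the `k` innermost guards ending in the step formula:
`chain k = G_{m-k} ⇒ ⋯ ⇒ G_{m-1} ⇒ Φ(X_m, Y_m)`. [cite: AroraBarakCC2009, Thm. 4.13 (proof)] -/
def chain : ℕ → PropForm ℕ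
  | 0 => Φ (xb N m) (yb N m)
  | k + 1 => impF (guard N (m - (k + 1))) (chain k)

/-- **The matrix**: `C_start = start ∧ acc(C_final) ∧ (G₀ ⇒ ⋯ ⇒ G_{m-1} ⇒ Φ(X_m, Y_m))`.
[cite: AroraBarakCC2009, Thm. 4.13 (proof, p. 112)] -/
def savitchMatrix : PropForm ℕ :=
  .conj (vecConst 0 start) (.conj (acc N) (chain Φ N m m))

/-- The quantifier blocks of the levels `t, …, m - 1`: `(∃^N ∀^{2N})` each. [folklore] -/
def lvlQuants : ℕ → List Bool
  | 0 => []
  | k + 1 => (List.replicate N false ++ List.replicate (2 * N) true) ++ lvlQuants k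

/-- **The prefix**: `∃^{2N}` (for `C_start, C_final`) followed by `(∃^N ∀^{2N})^m`.
[cite: AroraBarakCC2009, Thm. 4.13 (proof: "convert the final formula to prenex form")] -/
def savitchQuants : List Bool := List.replicate (2 * N) false ++ lvlQuants N m

/-- **The prenex Savitch formula.** [cite: AroraBarakCC2009, Thm. 4.13 (proof, p. 112)] -/
def savitchQBF : PrenexQBF := ⟨savitchQuants N m, savitchMatrix Φ acc start N m⟩

/-- Length of the level prefix. [folklore] -/
@[simp] theorem length_lvlQuants : ∀ k, (lvlQuants N k).length = 3 * N * k
  | 0 => by simp [lvlQuants]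
  | k + 1 => by simp [lvlQuants, length_lvlQuants k]; ring

/-- Length of the prefix: `2N + 3Nm` variables. [folklore] -/
theorem length_savitchQuants : (savitchQuants N m).length = 2 * N + 3 * N * m := by
  simp [savitchQuants]

/-- `2^ℓ` steps of the relation `Step`, by recursive doubling. [cite: AroraBarakCC2009, Thm. 4.13 (proof: "path of length at most 2ⁱ", here exactly 2ⁱ)] -/
def Reach (Step : List Bool → List Bool → Prop) : ℕ → List Bool → List Bool → Prop
  | 0, X, Y => Step X Y
  | ℓ + 1, X, Y => ∃ Z : List Bool, Z.length = N ∧ Reach Step ℓ X Z ∧ Reach Step ℓ Z Y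

/-- All guards of the levels `< t` hold. [folklore] -/
def GuardsHold (σ : ℕ → Bool) (t : ℕ) : Prop := ∀ t' < t, (guard N t').eval σ = true

variable {Φ acc start N m}
variable (Step : List Bool → List Bool → Prop) (Acc : List Bool → Prop)

/-- Semantics of the chain: the innermost `k` guards imply the step formula. [folklore] -/
theorem eval_chain (hΦ : ∀ σ a b, (Φ a b).eval σ = true ↔ Step (readVec σ a N) (readVec σ b N)) (σ : ℕ → Bool) :
    ∀ k, k ≤ m → ((chain Φ N m k).eval σ = true ↔
      ((∀ t', m - k ≤ t' → t' < m → (guard N t').eval σ = true) → Step (readVec σ (xb N m) N) (readVec σ (yb N m) N)))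
  | 0, _ => by
    rw [chain, hΦ]
    exact ⟨fun h _ => h, fun h => h fun t' h₁ h₂ => by omega⟩
  | k + 1, hk => by
    rw [chain, eval_impF, eval_chain hΦ σ k (by omega)]
    constructor
    · intro h hg
      exact h (hg _ le_rfl (by omega)) fun t' h₁ h₂ => hg t' (by omega) h₂
    · intro h hg hg'
      exact h fun t' h₁ h₂ => (Nat.eq_or_lt_of_le h₁).elim (fun he => he ▸ hg) fun hl => hg' t' (by omega) h₂

/-- The guards of the levels `< t` only mention variables below `lvl t`. [folklore] -/
theorem propFormVarBound_guard_le (t : ℕ) : propFormVarBound (guard N t) ≤ lvl N (t + 1) := by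
  have hx : xb N t + N ≤ lvl N t := by cases t <;> simp [xb, lvl] <;> ring_nf <;> omega
  have hy : yb N t + N ≤ lvl N t := by cases t <;> simp [yb, lvl] <;> ring_nf <;> omega
  have hl : lvl N t + 3 * N = lvl N (t + 1) := by simp [lvl]; ring
  simp only [guard, propFormVarBound, max_le_iff]
  refine ⟨⟨(propFormVarBound_vecEq_le _ _ _).trans ?_, (propFormVarBound_vecEq_le _ _ _).trans ?_⟩,
    ⟨(propFormVarBound_vecEq_le _ _ _).trans ?_, (propFormVarBound_vecEq_le _ _ _).trans ?_⟩⟩ <;> omega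

/-- The guards below level `t` are unaffected by writing at or above `lvl t`. [folklore] -/
theorem eval_guard_writeVec {t t' : ℕ} (ht : t' < t) (σ : ℕ → Bool) {a : ℕ} (ha : lvl N t ≤ a) (w : List Bool) :
    (guard N t').eval (writeVec σ a w) = (guard N t').eval σ := by
  refine propForm_eval_congr fun x hx => writeVec_of_lt σ _ w (lt_of_lt_of_le hx (le_trans ?_ ha))
  refine (propFormVarBound_guard_le t').trans ?_
  simp only [lvl]
  have : 3 * N * (t' + 1) ≤ 3 * N * t := Nat.mul_le_mul_left _ ht
  omega

/-- Writing a concatenation is writing the two parts. [folklore] -/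
theorem writeVec_append (σ : ℕ → Bool) : ∀ (a : ℕ) (d d' : List Bool),
    writeVec σ a (d ++ d') = writeVec (writeVec σ a d) (a + d.length) d'
  | a, [], d' => by simp [writeVec]
  | a, b :: d, d' => by
    rw [List.cons_append, writeVec, writeVec, writeVec_append _ (a + 1) d d']
    simp [Nat.add_assoc, Nat.add_comm 1]

/-- Reading the first part of a written concatenation. [folklore] -/
theorem readVec_writeVec_append_left (σ : ℕ → Bool) (a : ℕ) (d d' : List Bool) :
    readVec (writeVec σ a (d ++ d')) a d.length = d := by
  rw [writeVec_append, readVec_writeVec_of_le _ _ _ le_rfl, readVec_writeVec_self]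

/-- Reading the second part of a written concatenation. [folklore] -/
theorem readVec_writeVec_append_right (σ : ℕ → Bool) (a : ℕ) (d d' : List Bool) :
    readVec (writeVec σ a (d ++ d')) (a + d.length) d'.length = d' := by
  rw [writeVec_append, readVec_writeVec_self]

/-- A `∀` over words of length `2n` is a `∀` over pairs of words of length `n`. [folklore] -/
theorem forall_length_two_mul_iff {n : ℕ} {P : List Bool → Prop} :
    (∀ w : List Bool, w.length = 2 * n → P w) ↔ ∀ d d' : List Bool, d.length = n → d'.length = n → P (d ++ d') := by
  constructor
  · intro h d d' hd hd'
    exact h (d ++ d') (by simp [hd, hd']; ring)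
  · intro h w hw
    have := h (w.take n) (w.drop n) (by simp [hw]; omega) (by simp [hw]; omega)
    rwa [List.take_append_drop] at this

/-- **The semantic induction** ("the two definitions of `ψᵢ` are logically equivalent"): with the
`k` innermost levels still quantified, at level `t = m - k`, the formula says: the start pin and
the acceptance hold, and if the outer guards hold then `2^k` steps lead from `Xₜ` to `Yₜ`.
[cite: AroraBarakCC2009, Thm. 4.13 (proof, p. 112)] -/
theorem qbfEval_lvlQuants_iff (hΦ : ∀ σ a b, (Φ a b).eval σ = true ↔ Step (readVec σ a N) (readVec σ b N))
    (hacc : ∀ σ a, (acc a).eval σ = true ↔ Acc (readVec σ a N)) (hs : start.length ≤ N) :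
    ∀ (k t : ℕ), t + k = m → ∀ σ : ℕ → Bool,
      qbfEval (savitchMatrix Φ acc start N m) (lvlQuants N k) (lvl N t) σ = true ↔
        readVec σ 0 start.length = start ∧ Acc (readVec σ N N) ∧
          (GuardsHold N σ t → Reach N Step k (readVec σ (xb N t) N) (readVec σ (yb N t) N))
  | 0, t, htk, σ => by
    subst htk
    rw [lvlQuants, qbfEval, savitchMatrix, PropForm.eval, PropForm.eval, Bool.and_eq_true, Bool.and_eq_true,
      eval_vecConst, hacc, eval_chain Step hΦ σ (t + 0) le_rfl, Nat.sub_self]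
    simp only [GuardsHold, Reach, Nat.zero_le, true_implies, Nat.add_zero]
  | k + 1, t, htk, σ => by
    -- peel the block `∃ C''ₜ ∀ Dₜ ∀ D'ₜ`
    rw [lvlQuants, List.append_assoc, qbfEval_replicate_false_append]
    simp only [qbfEval_replicate_true_append]
    have hlvl : lvl N t + N + 2 * N = lvl N (t + 1) := by simp [lvl]; ring
    have hxb : xb N t + N ≤ lvl N t := by cases t <;> simp [xb, lvl] <;> ring_nf <;> omega
    have hyb : yb N t + N ≤ lvl N t := by cases t <;> simp [yb, lvl] <;> ring_nf <;> omega
    have h2N : 2 * N ≤ lvl N t := by simp [lvl]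
    -- the inner formula under the written blocks
    have key : ∀ c d d' : List Bool, c.length = N → d.length = N → d'.length = N →
        (qbfEval (savitchMatrix Φ acc start N m) (lvlQuants N k) (lvl N t + N + 2 * N)
            (writeVec (writeVec σ (lvl N t) c) (lvl N t + N) (d ++ d')) = true ↔
          readVec σ 0 start.length = start ∧ Acc (readVec σ N N) ∧
            (GuardsHold N σ t ∧ ((d = readVec σ (xb N t) N ∧ d' = c) ∨ (d = c ∧ d' = readVec σ (yb N t) N)) →
              Reach N Step k d d')) := by
      intro c d d' hc hd hd'
      set σ'' := writeVec (writeVec σ (lvl N t) c) (lvl N t + N) (d ++ d') with hσ''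
      have hr0 : readVec σ'' 0 start.length = readVec σ 0 start.length := by
        rw [hσ'', readVec_writeVec_of_le _ _ _ (by omega), readVec_writeVec_of_le _ _ _ (by omega)]
      have hrN : readVec σ'' N N = readVec σ N N := by
        rw [hσ'', readVec_writeVec_of_le _ _ _ (by omega), readVec_writeVec_of_le _ _ _ (by omega)]
      have hrx : readVec σ'' (xb N t) N = readVec σ (xb N t) N := by
        rw [hσ'', readVec_writeVec_of_le _ _ _ (by omega), readVec_writeVec_of_le _ _ _ hxb]
      have hry : readVec σ'' (yb N t) N = readVec σ (yb N t) N := by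
        rw [hσ'', readVec_writeVec_of_le _ _ _ (by omega), readVec_writeVec_of_le _ _ _ hyb]
      have hrc : readVec σ'' (lvl N t) N = c := by
        rw [hσ'', readVec_writeVec_of_le _ _ _ le_rfl]
        have := readVec_writeVec_self σ (lvl N t) c
        rwa [hc] at this
      have hrd : readVec σ'' (lvl N t + N) N = d := by
        have := readVec_writeVec_append_left (writeVec σ (lvl N t) c) (lvl N t + N) d d'
        rwa [hd] at this
      have hrd' : readVec σ'' (lvl N t + 2 * N) N = d' := by
        have := readVec_writeVec_append_right (writeVec σ (lvl N t) c) (lvl N t + N) d d'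
        rwa [hd, hd', show lvl N t + N + N = lvl N t + 2 * N by ring] at this
      have hG : GuardsHold N σ'' (t + 1) ↔
          GuardsHold N σ t ∧ ((d = readVec σ (xb N t) N ∧ d' = c) ∨ (d = c ∧ d' = readVec σ (yb N t) N)) := by
        constructor
        · intro h
          refine ⟨fun t' ht' => ?_, ?_⟩
          · have := h t' (by omega)
            rwa [hσ'', eval_guard_writeVec ht' _ (by omega), eval_guard_writeVec ht' _ le_rfl] at this
          · have := h t (Nat.lt_succ_self t)
            simp only [guard, PropForm.eval, Bool.or_eq_true, Bool.and_eq_true, eval_vecEq, hrd, hrx, hrc, hrd', hry] at this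
            exact this
        · rintro ⟨h, hg⟩ t' ht'
          rcases Nat.lt_succ_iff_lt_or_eq.1 ht' with ht' | rfl
          · rw [hσ'', eval_guard_writeVec ht' _ (by omega), eval_guard_writeVec ht' _ le_rfl]
            exact h t' ht'
          · simp only [guard, PropForm.eval, Bool.or_eq_true, Bool.and_eq_true, eval_vecEq, hrd, hrx, hrc, hrd', hry]
            exact hg
      rw [hlvl, qbfEval_lvlQuants_iff hΦ hacc hs k (t + 1) (by omega) σ'', hr0, hrN, hG]
      simp only [xb, yb, hrd, hrd']
    constructor
    · rintro ⟨c, hc, h⟩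
      have h' : ∀ d d' : List Bool, d.length = N → d'.length = N →
          (readVec σ 0 start.length = start ∧ Acc (readVec σ N N) ∧
            (GuardsHold N σ t ∧ ((d = readVec σ (xb N t) N ∧ d' = c) ∨ (d = c ∧ d' = readVec σ (yb N t) N)) →
              Reach N Step k d d')) := fun d d' hd hd' =>
        (key c d d' hc hd hd').1 (h (d ++ d') (by simp [hd, hd']; ring))
      obtain ⟨hp, ha, -⟩ := h' (readVec σ (xb N t) N) c (by simp) hc
      refine ⟨hp, ha, fun hGH => ⟨c, hc, ?_, ?_⟩⟩
      · exact (h' _ c (by simp) hc).2.2 ⟨hGH, Or.inl ⟨rfl, rfl⟩⟩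
      · exact (h' c _ hc (by simp)).2.2 ⟨hGH, Or.inr ⟨rfl, rfl⟩⟩
    · rintro ⟨hp, ha, himp⟩
      by_cases hGH : GuardsHold N σ t
      · obtain ⟨Z, hZ, h₁, h₂⟩ := himp hGH
        refine ⟨Z, hZ, ?_⟩
        rw [forall_length_two_mul_iff]
        intro d d' hd hd'
        rw [key Z d d' hZ hd hd']
        refine ⟨hp, ha, ?_⟩
        rintro ⟨-, (⟨rfl, rfl⟩ | ⟨rfl, rfl⟩)⟩
        · exact h₁
        · exact h₂
      · refine ⟨List.replicate N false, by simp, ?_⟩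
        rw [forall_length_two_mul_iff]
        intro d d' hd hd'
        rw [key _ d d' (by simp) hd hd']
        exact ⟨hp, ha, fun h => absurd h.1 hGH⟩

/-- **The Savitch formula is true iff an accepting block is reached from `start` in `2^m`
doubling levels.** [cite: AroraBarakCC2009, Thm. 4.13 (proof, p. 112: "true iff M accepts x")] -/
theorem isTrue_savitchQBF_iff (hΦ : ∀ σ a b, (Φ a b).eval σ = true ↔ Step (readVec σ a N) (readVec σ b N))
    (hacc : ∀ σ a, (acc a).eval σ = true ↔ Acc (readVec σ a N)) (hs : start.length = N) :
    (savitchQBF Φ acc start N m).IsTrue ↔ ∃ C : List Bool, C.length = N ∧ Acc C ∧ Reach N Step m start C := by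
  change qbfEval (savitchMatrix Φ acc start N m) (savitchQuants N m) 0 (fun _ => false) = true ↔ _
  rw [savitchQuants, two_mul, List.replicate_add, List.append_assoc, qbfEval_replicate_false_append]
  simp only [qbfEval_replicate_false_append, Nat.zero_add]
  have h0 : N + N = lvl N 0 := by simp [lvl, two_mul]
  constructor
  · rintro ⟨cs, hcs, cf, hcf, h⟩
    rw [h0, qbfEval_lvlQuants_iff Step Acc hΦ hacc hs.le m 0 (by simp) _] at h
    obtain ⟨hp, ha, hr⟩ := h
    have hrs : readVec (writeVec (writeVec (fun _ => false) 0 cs) N cf) 0 N = cs := by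
      rw [readVec_writeVec_of_le _ _ _ (by omega)]
      have := readVec_writeVec_self (fun _ => false) 0 cs
      rwa [hcs] at this
    have hrf : readVec (writeVec (writeVec (fun _ => false) 0 cs) N cf) N N = cf := by
      have := readVec_writeVec_self (writeVec (fun _ => false) 0 cs) N cf
      rwa [hcf] at this
    rw [hs, hrs] at hp
    subst hp
    rw [hrf] at ha
    refine ⟨cf, hcf, ha, ?_⟩
    have := hr fun t' ht' => absurd ht' (Nat.not_lt_zero _)
    simpa only [xb, yb, hrs, hrf] using this
  · rintro ⟨cf, hcf, ha, hr⟩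
    refine ⟨start, hs, cf, hcf, ?_⟩
    rw [h0, qbfEval_lvlQuants_iff Step Acc hΦ hacc hs.le m 0 (by simp) _]
    have hrs : readVec (writeVec (writeVec (fun _ => false) 0 start) N cf) 0 N = start := by
      rw [readVec_writeVec_of_le _ _ _ (by omega)]
      have := readVec_writeVec_self (fun _ => false) 0 start
      rwa [hs] at this
    have hrf : readVec (writeVec (writeVec (fun _ => false) 0 start) N cf) N N = cf := by
      have := readVec_writeVec_self (writeVec (fun _ => false) 0 start) N cf
      rwa [hcf] at this
    refine ⟨by rw [hs, hrs], by rw [hrf]; exact ha, fun _ => ?_⟩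
    simpa only [xb, yb, hrs, hrf] using hr

/-- The chain mentions variables below `lvl m`. [folklore] -/
theorem propFormVarBound_chain_le (hΦv : ∀ a b, propFormVarBound (Φ a b) ≤ max (a + N) (b + N)) :
    ∀ k, k ≤ m → propFormVarBound (chain Φ N m k) ≤ lvl N m
  | 0, _ => by
    have hx : xb N m + N ≤ lvl N m := by cases m <;> simp [xb, lvl] <;> ring_nf <;> omega
    have hy : yb N m + N ≤ lvl N m := by cases m <;> simp [yb, lvl] <;> ring_nf <;> omega
    exact (hΦv _ _).trans (max_le hx hy)
  | k + 1, hk => by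
    rw [chain, propFormVarBound_impF, max_le_iff]
    refine ⟨(propFormVarBound_guard_le _).trans ?_, propFormVarBound_chain_le hΦv k (by omega)⟩
    simp only [lvl]
    have : 3 * N * (m - (k + 1) + 1) ≤ 3 * N * m := Nat.mul_le_mul_left _ (by omega)
    omega

/-- **The Savitch formula is closed** (given the variable bounds of the step and acceptance
formulas). [cite: AroraBarakCC2009, Def. 4.10] -/
theorem isClosed_savitchQBF (hΦv : ∀ a b, propFormVarBound (Φ a b) ≤ max (a + N) (b + N))
    (haccv : ∀ a, propFormVarBound (acc a) ≤ a + N) (hs : start.length ≤ N) :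
    (savitchQBF Φ acc start N m).IsClosed := by
  change propFormVarBound (savitchMatrix Φ acc start N m) ≤ (savitchQuants N m).length
  rw [length_savitchQuants, savitchMatrix, propFormVarBound, propFormVarBound, max_le_iff, max_le_iff]
  refine ⟨(propFormVarBound_vecConst_le _ _).trans (by omega), (haccv N).trans (by omega), ?_⟩
  exact (propFormVarBound_chain_le hΦv m le_rfl).trans (by simp [lvl])

end Savitch

end TQBFRed

end Literature.Barriers.QuantumAdvantage
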